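import Mathlib
import Summits.Ventures.PercRepro2.CrossAPrimeA1VDict
import Summits.Ventures.PercRepro2.CrossAPrimeA1VMid
import Summits.Ventures.PercRepro2.CrossAPrimeA2V

/-!
# The Bernstein excesses of `crossA′so` along an `a₁`-edge: two exact identities
(blind cell PercRepro2, p5 g33; `proofs/P5-OEDGE.md` §43, S4 §2.4 (s) addendum 23)

Along any edge `e` the one-edge cubic `crossA'so_pin_cubic` has the Bernstein coefficients
`B₀ = Φ₀₀₀`, `3B₁ = Φ₁₀₀ + Φ₀₁₀ + Φ₀₀₁`, `3B₂ = Φ₁₁₀ + Φ₁₀₁ + Φ₀₁₁`, `B₃ = Φ₁₁₁` with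
`Φ_ε = crossPat` on the pinned measures, and the two excesses `E₁ = 3B₁ − B₀`, `E₂ = 3B₂ − B₃`.
Writing `m⁰` / `m¹` for the masses of `p[e ↦ 0]` / `p[e ↦ 1]` and
`M(a; b) := 2Z_a·Dv_b − y_a·xv_b − x_a·yv_b + π_b·x_a·y_a` (`Q`-masses from `a`, `v`-masses from `b`;
`B₀ = M(m⁰; m⁰)`, `B₃ = M(m¹; m¹)`), the definitions give, for EVERY edge, the ring identities

* **`E1_sub_E2`**: `E₁ − E₂ = (π¹ − π⁰)·(x⁰ − x¹)·(y⁰ − y¹)`;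
* **`E2_sub_B3`**: `E₂ − B₃ = first + M(m¹; m⁰)` with
  `first := (y⁰ − y¹)·(π¹x¹ − xv¹) + (x⁰ − x¹)·(π¹y¹ − yv¹) + 2(Z⁰ − Z¹)·Dv¹`.

For an edge `e = {a₁, w}` AT THE ROOT the dictionary `prob_update_one_Q_inter` gives
`Z¹ ≤ Z⁰`, `x¹ ≤ x⁰`, `y¹ ≤ y⁰`, monotonicity gives `π⁰ ≤ π¹` (`prob_vL_update_mono`), and
`prob_Q_vL_oH_le` gives `xv¹ ≤ π¹x¹`, `yv¹ ≤ π¹y¹`; hence **`E2_le_E1`** (`E₂ ≤ E₁`) and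
**`first_nonneg`** (`0 ≤ first`).  So along a root edge the reduction
`(1 − q)²·crossA′so(p[e ↦ 0]) ≤ crossA′so(p)` follows from `0 ≤ B₃` and the single inequality
`0 ≤ first + M(m¹; m⁰)` (**`reduction_of_mixed`**): the open statement `RootEdgeReductionStep`
is reduced to the sign of the mixed form `first + M(m¹; m⁰)`.  Own work; standard axioms.
-/

namespace Summit.Ventures.PercRepro2

open LeafRowPendantRootSO CrossAPrimeA1VMid CrossAPrimeA1VDict CrossAPrimeA2V

namespace CrossAPrimeEdgeIdentities

section Identities

variable {V : Type*} {E : Type*} [Fintype E] [DecidableEq E] {R : Type*} [Field R]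
  {ends : E → Sym2 V}

/-- The mixed form `M(a; b) = 2Z_a·Dv_b − y_a·xv_b − x_a·yv_b + π_b·x_a·y_a`: `Q`-masses on the
measure `pa`, `v`-masses on the measure `pb`. -/
noncomputable def mixed (pa pb : E → R) (ends : E → Sym2 V) (o a₁ a₂ v b : V) : R :=
  2 * prob pa (avoidAll ends a₂ {a₁}) *
      prob pb (avoidAll ends a₂ {a₁} ∩ (connEvent ends a₁ v ∩ (connEvent ends a₂ o ∩ connEvent ends a₂ b))) -
    prob pa (avoidAll ends a₂ {a₁} ∩ connEvent ends a₂ b) *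
      prob pb (avoidAll ends a₂ {a₁} ∩ (connEvent ends a₁ v ∩ connEvent ends a₂ o)) -
    prob pa (avoidAll ends a₂ {a₁} ∩ connEvent ends a₂ o) *
      prob pb (avoidAll ends a₂ {a₁} ∩ (connEvent ends a₁ v ∩ connEvent ends a₂ b)) +
    prob pb (connEvent ends a₁ v) * prob pa (avoidAll ends a₂ {a₁} ∩ connEvent ends a₂ o) *
      prob pa (avoidAll ends a₂ {a₁} ∩ connEvent ends a₂ b)

/-- The diagonal mixed form is `crossA′so`. -/
lemma crossA'so_eq_mixed (p : E → R) (ends : E → Sym2 V) (o a₁ a₂ v b : V) :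
    crossA'so p ends o a₁ a₂ v b = mixed p p ends o a₁ a₂ v b := by
  unfold crossA'so mixed
  ring

/-- The first excess `E₁ = 3B₁ − B₀` along `e`. -/
noncomputable def E1 (p : E → R) (e : E) (ends : E → Sym2 V) (o a₁ a₂ v b : V) : R :=
  crossPat (Function.update p e 1) (Function.update p e 0) (Function.update p e 0) ends o a₁ a₂ v b +
    crossPat (Function.update p e 0) (Function.update p e 1) (Function.update p e 0) ends o a₁ a₂ v b +
    crossPat (Function.update p e 0) (Function.update p e 0) (Function.update p e 1) ends o a₁ a₂ v b -
    crossPat (Function.update p e 0) (Function.update p e 0) (Function.update p e 0) ends o a₁ a₂ v b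

/-- The second excess `E₂ = 3B₂ − B₃` along `e`. -/
noncomputable def E2 (p : E → R) (e : E) (ends : E → Sym2 V) (o a₁ a₂ v b : V) : R :=
  crossPat (Function.update p e 1) (Function.update p e 1) (Function.update p e 0) ends o a₁ a₂ v b +
    crossPat (Function.update p e 1) (Function.update p e 0) (Function.update p e 1) ends o a₁ a₂ v b +
    crossPat (Function.update p e 0) (Function.update p e 1) (Function.update p e 1) ends o a₁ a₂ v b -
    crossPat (Function.update p e 1) (Function.update p e 1) (Function.update p e 1) ends o a₁ a₂ v b

/-- The nonnegative part of the second excess along a root edge: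
`first = (y⁰ − y¹)(π¹x¹ − xv¹) + (x⁰ − x¹)(π¹y¹ − yv¹) + 2(Z⁰ − Z¹)Dv¹`. -/
noncomputable def first (p : E → R) (e : E) (ends : E → Sym2 V) (o a₁ a₂ v b : V) : R :=
  (prob (Function.update p e 0) (avoidAll ends a₂ {a₁} ∩ connEvent ends a₂ b) -
      prob (Function.update p e 1) (avoidAll ends a₂ {a₁} ∩ connEvent ends a₂ b)) *
    (prob (Function.update p e 1) (connEvent ends a₁ v) *
        prob (Function.update p e 1) (avoidAll ends a₂ {a₁} ∩ connEvent ends a₂ o) -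
      prob (Function.update p e 1) (avoidAll ends a₂ {a₁} ∩ (connEvent ends a₁ v ∩ connEvent ends a₂ o))) +
  (prob (Function.update p e 0) (avoidAll ends a₂ {a₁} ∩ connEvent ends a₂ o) -
      prob (Function.update p e 1) (avoidAll ends a₂ {a₁} ∩ connEvent ends a₂ o)) *
    (prob (Function.update p e 1) (connEvent ends a₁ v) *
        prob (Function.update p e 1) (avoidAll ends a₂ {a₁} ∩ connEvent ends a₂ b) -
      prob (Function.update p e 1) (avoidAll ends a₂ {a₁} ∩ (connEvent ends a₁ v ∩ connEvent ends a₂ b))) +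
  2 * (prob (Function.update p e 0) (avoidAll ends a₂ {a₁}) -
      prob (Function.update p e 1) (avoidAll ends a₂ {a₁})) *
    prob (Function.update p e 1) (avoidAll ends a₂ {a₁} ∩
      (connEvent ends a₁ v ∩ (connEvent ends a₂ o ∩ connEvent ends a₂ b)))

/-- **`E₁ − E₂ = (π¹ − π⁰)(x⁰ − x¹)(y⁰ − y¹)`** along any edge (a ring identity of the patterns). -/
theorem E1_sub_E2 (p : E → R) (e : E) (ends : E → Sym2 V) (o a₁ a₂ v b : V) :
    E1 p e ends o a₁ a₂ v b - E2 p e ends o a₁ a₂ v b =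
      (prob (Function.update p e 1) (connEvent ends a₁ v) -
          prob (Function.update p e 0) (connEvent ends a₁ v)) *
        (prob (Function.update p e 0) (avoidAll ends a₂ {a₁} ∩ connEvent ends a₂ o) -
          prob (Function.update p e 1) (avoidAll ends a₂ {a₁} ∩ connEvent ends a₂ o)) *
        (prob (Function.update p e 0) (avoidAll ends a₂ {a₁} ∩ connEvent ends a₂ b) -
          prob (Function.update p e 1) (avoidAll ends a₂ {a₁} ∩ connEvent ends a₂ b)) := by
  unfold E1 E2 crossPat
  ring

/-- **`E₂ − B₃ = first + M(m¹; m⁰)`** along any edge (a ring identity of the patterns). -/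
theorem E2_sub_B3 (p : E → R) (e : E) (ends : E → Sym2 V) (o a₁ a₂ v b : V) :
    E2 p e ends o a₁ a₂ v b - crossA'so (Function.update p e 1) ends o a₁ a₂ v b =
      first p e ends o a₁ a₂ v b +
        mixed (Function.update p e 1) (Function.update p e 0) ends o a₁ a₂ v b := by
  unfold E2 first mixed crossPat crossA'so
  ring

/-- The one-edge cubic in terms of the excesses:
`crossA′so(p) = (1 − q)³B₀ + q(1 − q)²(E₁ + B₀) + q²(1 − q)(E₂ + B₃) + q³B₃`. -/
theorem crossA'so_eq_excess (p : E → R) (e : E) (ends : E → Sym2 V) (o a₁ a₂ v b : V) :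
    crossA'so p ends o a₁ a₂ v b =
      (1 - p e) ^ 3 * crossA'so (Function.update p e 0) ends o a₁ a₂ v b +
        p e * (1 - p e) ^ 2 *
          (E1 p e ends o a₁ a₂ v b + crossA'so (Function.update p e 0) ends o a₁ a₂ v b) +
        p e ^ 2 * (1 - p e) *
          (E2 p e ends o a₁ a₂ v b + crossA'so (Function.update p e 1) ends o a₁ a₂ v b) +
        p e ^ 3 * crossA'so (Function.update p e 1) ends o a₁ a₂ v b := by
  rw [crossA'so_pin_cubic p ends e, crossA'so_eq_crossPat (Function.update p e 0),
    crossA'so_eq_crossPat (Function.update p e 1)]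
  unfold E1 E2
  ring

end Identities

section RootEdge

variable {V : Type*} {E : Type*} [Fintype E] [DecidableEq E] [Fintype V] [DecidableEq V]
  {R : Type*} [Field R] [LinearOrder R] [IsStrictOrderedRing R]
variable {ends : E → Sym2 V}

omit [Fintype V] in
/-- Along a root edge `e = {a₁, w}`, the `Q`-masses decrease when `e` opens (the dictionary and
the double avoidance): `x¹ ≤ x⁰` for the `a₂`-event `X`. -/
lemma prob_update_one_Q_le {p : E → R} (hp : IsProbVec p) {e : E} {a₁ w : V}
    (he : ends e = s(a₁, w)) {a₂ : V} {X : Set (Config E)}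
    (hX : ∀ ω : Config E, ¬ Conn ends ω a₂ a₁ → ¬ Conn ends ω a₂ w →
      (Function.update ω e true ∈ X ↔ ω ∈ X)) :
    prob (Function.update p e 1) (avoidAll ends a₂ {a₁} ∩ X) ≤
      prob (Function.update p e 0) (avoidAll ends a₂ {a₁} ∩ X) := by
  rw [prob_update_one_Q_inter p he hX]
  exact prob_mono (hp.update e le_rfl zero_le_one)
    (Set.inter_subset_inter_left _ (avoid_pair_subset a₂))

omit [Fintype V] in
/-- Along a root edge `e = {a₁, w}`: `Z¹ ≤ Z⁰`. -/
lemma prob_update_one_Q_le' {p : E → R} (hp : IsProbVec p) {e : E} {a₁ w : V}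
    (he : ends e = s(a₁, w)) (a₂ : V) :
    prob (Function.update p e 1) (avoidAll ends a₂ {a₁}) ≤
      prob (Function.update p e 0) (avoidAll ends a₂ {a₁}) := by
  have h := prob_update_one_Q_le hp he (a₂ := a₂) (X := Set.univ) (hX_univ (a₂ := a₂))
  simpa only [Set.inter_univ] using h

omit [Fintype V] in
/-- **`E₂ ≤ E₁` along a root edge**. -/
theorem E2_le_E1 {p : E → R} (hp : IsProbVec p) {e : E} {a₁ w : V} (he : ends e = s(a₁, w))
    (o a₂ v b : V) : E2 p e ends o a₁ a₂ v b ≤ E1 p e ends o a₁ a₂ v b := by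
  have h := E1_sub_E2 p e ends o a₁ a₂ v b
  have hπ : 0 ≤ prob (Function.update p e 1) (connEvent ends a₁ v) -
      prob (Function.update p e 0) (connEvent ends a₁ v) :=
    sub_nonneg.2 (prob_vL_update_mono hp e a₁ v)
  have hx := sub_nonneg.2 (prob_update_one_Q_le hp he (hX_conn he a₂ o))
  have hy := sub_nonneg.2 (prob_update_one_Q_le hp he (hX_conn he a₂ b))
  have := mul_nonneg (mul_nonneg hπ hx) hy
  linarith

/-- **`0 ≤ first` along a root edge**. -/
theorem first_nonneg {p : E → R} (hp : IsProbVec p) {e : E} {a₁ w : V} (he : ends e = s(a₁, w))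
    (o a₂ v b : V) : 0 ≤ first p e ends o a₁ a₂ v b := by
  have hp1 : IsProbVec (Function.update p e 1) := hp.update e zero_le_one le_rfl
  have hZ := sub_nonneg.2 (prob_update_one_Q_le' hp he a₂)
  have hx := sub_nonneg.2 (prob_update_one_Q_le hp he (hX_conn he a₂ o))
  have hy := sub_nonneg.2 (prob_update_one_Q_le hp he (hX_conn he a₂ b))
  have hxv := sub_nonneg.2 (prob_Q_vL_oH_le (ends := ends) (Function.update p e 1) hp1 a₁ a₂ v o)
  have hyv := sub_nonneg.2 (prob_Q_vL_oH_le (ends := ends) (Function.update p e 1) hp1 a₁ a₂ v b)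
  have hDv := prob_nonneg hp1 (avoidAll ends a₂ {a₁} ∩
    (connEvent ends a₁ v ∩ (connEvent ends a₂ o ∩ connEvent ends a₂ b)))
  unfold first
  have h1 := mul_nonneg hy hxv
  have h2 := mul_nonneg hx hyv
  have h3 := mul_nonneg (mul_nonneg (by norm_num : (0 : R) ≤ 2) hZ) hDv
  linarith

omit [Fintype V] in
/-- **The root-edge reduction modulo the mixed sign**: along `e = {a₁, w}`, if
`0 ≤ crossA′so(p[e ↦ 1])` and `0 ≤ first + M(m¹; m⁰)`, then
`(1 − p e)²·crossA′so(p[e ↦ 0]) ≤ crossA′so(p)`. -/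
theorem reduction_of_mixed {p : E → R} (hp : IsProbVec p) {e : E} {a₁ w : V}
    (he : ends e = s(a₁, w)) (o a₂ v b : V)
    (h3 : 0 ≤ crossA'so (Function.update p e 1) ends o a₁ a₂ v b)
    (hmix : 0 ≤ first p e ends o a₁ a₂ v b +
      mixed (Function.update p e 1) (Function.update p e 0) ends o a₁ a₂ v b) :
    (1 - p e) ^ 2 * crossA'so (Function.update p e 0) ends o a₁ a₂ v b ≤
      crossA'so p ends o a₁ a₂ v b := by
  have hq0 : 0 ≤ p e := hp.nonneg e
  have hq1 : p e ≤ 1 := hp.le_one e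
  have hE2 : crossA'so (Function.update p e 1) ends o a₁ a₂ v b ≤ E2 p e ends o a₁ a₂ v b := by
    have := E2_sub_B3 p e ends o a₁ a₂ v b
    linarith
  have hE1 := E2_le_E1 hp he o a₂ v b
  rw [crossA'so_eq_excess p e ends o a₁ a₂ v b]
  have hq01 : 0 ≤ p e * (1 - p e) ^ 2 := mul_nonneg hq0 (sq_nonneg _)
  have hq2 : 0 ≤ p e ^ 2 * (1 - p e) := mul_nonneg (sq_nonneg _) (sub_nonneg.2 hq1)
  have hq3 : 0 ≤ p e ^ 3 := pow_nonneg hq0 3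
  have hE1' : 0 ≤ E1 p e ends o a₁ a₂ v b := by linarith
  have hE2' : 0 ≤ E2 p e ends o a₁ a₂ v b + crossA'so (Function.update p e 1) ends o a₁ a₂ v b := by
    linarith
  have k1 := mul_nonneg hq01 hE1'
  have k2 := mul_nonneg hq2 hE2'
  have k3 := mul_nonneg hq3 h3
  have hcube : (1 - p e) ^ 3 * crossA'so (Function.update p e 0) ends o a₁ a₂ v b +
      p e * (1 - p e) ^ 2 * crossA'so (Function.update p e 0) ends o a₁ a₂ v b =
      (1 - p e) ^ 2 * crossA'so (Function.update p e 0) ends o a₁ a₂ v b := by ring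
  nlinarith [k1, k2, k3, hcube]

end RootEdge

end CrossAPrimeEdgeIdentities

end Summit.Ventures.PercRepro2
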